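import Literature.AnabelianGeometry.SemiGraphs.TemperedConj2OfLocallyFinite
import Literature.AnabelianGeometry.SemiGraphs.TemperedAnchoredCompactOfLocallyFinite
import Literature.AnabelianGeometry.SemiGraphs.ThetaRayGraph
import HarnessLib

/-!
# [SemiAnbd] Thm 3.7 (iii) at the countermodel `𝒢_θ`: sentences 2–3 HOLD (every chart), next to ¬ sentence 1

Mochizuki, *Semi-graphs of anabelioids*, Publ. RIMS **42** (2006), §3, Theorem 3.7 (iii) pp. 40–41
[cite: MochizukiSemiAnbd2006, Thm 3.7(iii) pp.40-41]; the binder-form graph of anabelioids `𝒢_θ` on the ray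
(`thetaRay G E up low`, abc-iut-L3-d1, [SemiAnbd] Def 2.1 p. 22).

PROOF-ONLY certificate (cell abc-iut, layer L3, GAP row G-t6g3-2b; seat abc-iut-w6-d062; no definition).
abc-iut-L3-d1's FRONTIER programme shows `¬ CompactInVerticialAt 𝒢_θ` (escaping compact subgroups:
`thetaRay_not_compactInVerticialAt_of_levelEscape` / `_of_hcrit`), i.e. the EXISTENCE sentence of Thm 3.7 (iii)
fails at an infinite countable `𝔾`.  The ray is LOCALLY FINITE (`SemiGraph.ray_isLocallyFinite`), so this seat's
`compactInTwoVerticial_of_isLocallyFinite` (`TemperedConj2OfLocallyFinite.lean`, HBDD-LOCFIN programme) applies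
verbatim: at the SAME `𝒢_θ`, under the SAME hypotheses `Thm37Hypotheses`, the UNIQUENESS and EDGE sentences of
Thm 3.7 (iii) hold in every chart — the erratum split of G-t6g3-2b made concrete at one object:
sentence 1 ⇔ finite-type input (fails here), sentences 2–3 ⇐ local finiteness (hold here).

Nothing here asserts `Thm37Hypotheses 𝒢_θ` (it is a binder, assembled from bricks in
`ThetaRayGraphHypotheses.lean`); nothing bears on [IUTchIII] Cor. 3.12; typed ≠ proved.
-/

namespace Literature.AnabelianGeometry.SemiGraphs

namespace ProfiniteSemiGraph

open CategoryTheory Topology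

section ThetaRayConj2

variable {G E : Type} [Group G] [TopologicalSpace G] [IsTopologicalGroup G] [CompactSpace G]
  [TotallyDisconnectedSpace G] [Group E] [TopologicalSpace E] [IsTopologicalGroup E] [CompactSpace E]
  [TotallyDisconnectedSpace E] {up : E →ₜ* G} {low : ℕ → (E →ₜ* G)}

/-- **Thm 3.7 (iii), sentences 2–3, at `𝒢_θ` (every chart)**: for `𝒢_θ = thetaRay G E up low` satisfying the
hypotheses of Thm 3.7, a nontrivial compact subgroup of `π₁^temp(𝒢_θ)` contained in two distinct verticial
subgroups `H₁ ≠ H₂` is contained in no third one, and lies in an edge-like subgroup of a closed edge — although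
`CompactInVerticialAt 𝒢_θ` (sentence 1 included) is false under level escape (abc-iut-L3-d1).
[cite: MochizukiSemiAnbd2006, Thm 3.7(iii) pp.40-41] -/
theorem thetaRay_compactInTwoVerticial (h37 : (thetaRay G E up low).Thm37Hypotheses)
    (c : TemperedPiChart (thetaRay G E up low)) (C : Subgroup c.G) (hCc : IsCompact (C : Set c.G)) (hC : C ≠ ⊥)
    {v₁ v₂ : (thetaRay G E up low).graph.Vertex} {H₁ H₂ : Subgroup c.G}
    (hH₁ : H₁ ∈ verticialSubgroups c v₁) (hH₂ : H₂ ∈ verticialSubgroups c v₂) (hne : H₁ ≠ H₂)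
    (hC₁ : C ≤ H₁) (hC₂ : C ≤ H₂) :
    (∀ (v₃ : (thetaRay G E up low).graph.Vertex) (H₃ : Subgroup c.G), H₃ ∈ verticialSubgroups c v₃ → C ≤ H₃ →
        H₃ = H₁ ∨ H₃ = H₂) ∧
      ∃ (e : (thetaRay G E up low).graph.Edge) (L : Subgroup c.G), (thetaRay G E up low).graph.IsClosedEdge e ∧
        L ∈ edgeLikeSubgroups c e ∧ C ≤ L :=
  (thetaRay G E up low).compactInTwoVerticial_of_isLocallyFinite h37 SemiGraph.ray_isLocallyFinite c C hCc hC
    hH₁ hH₂ hne hC₁ hC₂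

/-- **At `𝒢_θ`, Thm 3.7 (iii) is EQUIVALENT to its existence sentence** (the ray is locally finite): an instance
of `compactInVerticialAt_iff_exists_verticial_of_isLocallyFinite`. [cite: MochizukiSemiAnbd2006, Thm 3.7(iii) pp.40-41] -/
theorem thetaRay_compactInVerticialAt_iff :
    CompactInVerticialAt (thetaRay G E up low) ↔
      ((thetaRay G E up low).Thm37Hypotheses → ∀ (c : TemperedPiChart (thetaRay G E up low)) (C : Subgroup c.G),
        IsCompact (C : Set c.G) →
          ∃ (v : (thetaRay G E up low).graph.Vertex) (H : Subgroup c.G), H ∈ verticialSubgroups c v ∧ C ≤ H) :=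
  (thetaRay G E up low).compactInVerticialAt_iff_exists_verticial_of_isLocallyFinite SemiGraph.ray_isLocallyFinite

/-- **The erratum split at `𝒢_θ` in one statement**: whatever refutes `CompactInVerticialAt 𝒢_θ` refutes its
FIRST conjunct (existence) — given `¬ CompactInVerticialAt 𝒢_θ`, some chart carries a compact subgroup contained
in NO verticial subgroup (the second conjunct being a theorem at the locally finite ray).
[cite: MochizukiSemiAnbd2006, Thm 3.7(iii) pp.40-41] -/
theorem thetaRay_exists_compact_forall_not_le_verticial (hnot : ¬ CompactInVerticialAt (thetaRay G E up low)) :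
    ∃ (c : TemperedPiChart (thetaRay G E up low)) (C : Subgroup c.G), IsCompact (C : Set c.G) ∧
      ∀ (v : (thetaRay G E up low).graph.Vertex) (H : Subgroup c.G), H ∈ verticialSubgroups c v → ¬ C ≤ H :=
  (thetaRay G E up low).exists_compact_forall_not_le_verticial_of_isLocallyFinite SemiGraph.ray_isLocallyFinite
    hnot

/-- **Thm 3.7 (iii), first sentence, for ANCHORED compact subgroups at `𝒢_θ` (every chart)**: a compact
subgroup of `π₁^temp(𝒢_θ)` meeting some verticial subgroup nontrivially lies in a verticial subgroup — an
instance of `exists_verticial_ge_of_inf_verticial_ne_bot_of_isLocallyFinite` at the locally finite ray.  So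
the escaping compact subgroups of abc-iut-L3-d1's countermodel are ANCHOR-FREE.
[cite: MochizukiSemiAnbd2006, Thm 3.7(iii) pp.40-41] -/
theorem thetaRay_exists_verticial_ge_of_inf_verticial_ne_bot (h37 : (thetaRay G E up low).Thm37Hypotheses)
    (c : TemperedPiChart (thetaRay G E up low)) (K : Subgroup c.G) (hKc : IsCompact (K : Set c.G))
    {v₀ : (thetaRay G E up low).graph.Vertex} {H₀ : Subgroup c.G} (hH₀ : H₀ ∈ verticialSubgroups c v₀)
    (hanch : K ⊓ H₀ ≠ ⊥) :
    ∃ (v : (thetaRay G E up low).graph.Vertex) (H : Subgroup c.G), H ∈ verticialSubgroups c v ∧ K ≤ H :=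
  (thetaRay G E up low).exists_verticial_ge_of_inf_verticial_ne_bot_of_isLocallyFinite h37
    SemiGraph.ray_isLocallyFinite c K hKc hH₀ hanch

/-- **`¬ CompactInVerticialAt 𝒢_θ` ⇒ a nontrivial ANCHOR-FREE compact subgroup in some chart** (compact, `≠ 1`,
meeting every verticial subgroup trivially): the kernel form of "the only violators at a locally finite graph
are anchor-free" at the countermodel. [cite: MochizukiSemiAnbd2006, Thm 3.7(iii) pp.40-41] -/
theorem thetaRay_exists_anchorFree_of_not_compactInVerticialAt
    (hnot : ¬ CompactInVerticialAt (thetaRay G E up low)) :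
    ∃ (c : TemperedPiChart (thetaRay G E up low)) (K : Subgroup c.G), IsCompact (K : Set c.G) ∧ K ≠ ⊥ ∧
      ∀ (v : (thetaRay G E up low).graph.Vertex) (H : Subgroup c.G), H ∈ verticialSubgroups c v → K ⊓ H = ⊥ :=
  (thetaRay G E up low).exists_anchorFree_of_not_compactInVerticialAt_of_isLocallyFinite
    SemiGraph.ray_isLocallyFinite hnot

end ThetaRayConj2

end ProfiniteSemiGraph

end Literature.AnabelianGeometry.SemiGraphs
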